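import Mathlib
import Summits.NavierStokesRegularity.NavierStokesRegularity.Theses.L3TimeExponentPincer
import Summits.NavierStokesRegularity.NavierStokesRegularity.Theorems.L3TimeExponentPincerEffNode
import Summits.NavierStokesRegularity.NavierStokesRegularity.Theorems.L3TimeExponentPincerSmoothBranch
import HarnessLib.Audit
import HarnessLib

/-!
# Route `L3TimeExponentPincer` — the GLUE of the split of `L3CascadeJaw`

Item stmt-NavierStokesRegularity-19141 (`Theses.L3TimeExponentPincer.L3CascadeJawOfSplit :
EffSatBlowup → JawSmoothBranch → L3CascadeJaw`): the children imply the parent.  The hard child `EffSatBlowup`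
(K₃(1) on the blow-up branch) alone gives the crux via the landed one-stub composition
`Theorems.L3TimeExponentPincerSmoothBranch.l3CascadeJaw_of_effSatBlowup` (p414110), whose hypothesis
`Theorems.L3TimeExponentPincerEffNode.EffSatBlowup` is the definitional twin of the route child; the smooth-branch
child is not even needed (it is a theorem, used inside that composition).
-/

namespace Summit.NavierStokesRegularity.NavierStokesRegularity.Theorems.L3TimeExponentPincerSplitGlue

open Summit.NavierStokesRegularity.NavierStokesRegularity.Theorems.L3TimeExponentPincerSmoothBranch

/-- **Item `L3TimeExponentPincer.L3CascadeJawOfSplit` (stmt-NavierStokesRegularity-19141) holds**: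
`EffSatBlowup → JawSmoothBranch → L3CascadeJaw`, by `l3CascadeJaw_of_effSatBlowup`. -/
theorem l3CascadeJawOfSplit_item :
    Summit.NavierStokesRegularity.NavierStokesRegularity.Theses.L3TimeExponentPincer.L3CascadeJawOfSplit :=
  fun h _ => l3CascadeJaw_of_effSatBlowup h


end Summit.NavierStokesRegularity.NavierStokesRegularity.Theorems.L3TimeExponentPincerSplitGlue
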